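import Literature.NumberTheory.EllipticCurves.ManinConstantSemistablePrimewise
import Literature.NumberTheory.EllipticCurves.ManinConstantClassCertificateTwistGamma0Proofs
import Literature.NumberTheory.EllipticCurves.ManinConstantClassCertificateTwist
import Literature.NumberTheory.EllipticCurves.ManinConstantClassCertificate
import Literature.NumberTheory.EllipticCurves.IsogenyConductorModularityProofs
import Literature.NumberTheory.EllipticCurves.IsogenyIdProofs
import Literature.NumberTheory.EllipticCurves.IsogenyQuadraticTwistProofs
import Literature.NumberTheory.EllipticCurves.GlobalMinimalModelProofs
import Summits.BirchSwinnertonDyer.Rank1Residual.Additive.GordTwistMinimalModel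
import Summits.BirchSwinnertonDyer.Rank1Residual.ManinAdditive.TwistOrbitDegreeIdentity
import Summits.BirchSwinnertonDyer.BirchSwinnertonDyer.Theorems.ManinLocalTwoThreeExistsMinimalOptimalDatumUnconditional
import Summits.BirchSwinnertonDyer.BirchSwinnertonDyer.Theorems.ManinLocalTwoThreeEtaIdentitiesTwenty
import Summits.BirchSwinnertonDyer.BirchSwinnertonDyer.Theorems.ManinLocalTwoThreeEtaIdentitiesTwentyFour
import Summits.BirchSwinnertonDyer.BirchSwinnertonDyer.Theorems.ManinLocalTwoThreeLigozatIdentitiesTwentySeven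
import Summits.BirchSwinnertonDyer.BirchSwinnertonDyer.Theorems.ManinLocalTwoThreeLigozatIdentitiesThirtyTwo
import Summits.BirchSwinnertonDyer.BirchSwinnertonDyer.Theorems.ManinLocalTwoThreeLigozatIdentitiesThirtySix
import Summits.BirchSwinnertonDyer.BirchSwinnertonDyer.Theorems.ManinLocalTwoThreeEtaIdentitiesForty
import Summits.BirchSwinnertonDyer.BirchSwinnertonDyer.Theorems.ManinLocalTwoThreeManinConstantFortyFour
import Summits.BirchSwinnertonDyer.BirchSwinnertonDyer.Theorems.ManinLocalTwoThreeManinConstantFortyFive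
import Summits.BirchSwinnertonDyer.BirchSwinnertonDyer.Theorems.ManinLocalTwoThreeEtaIdentitiesFortyEight
import Summits.BirchSwinnertonDyer.BirchSwinnertonDyer.Theorems.ManinLocalTwoThreeManinConstantFiftySix
import Summits.BirchSwinnertonDyer.BirchSwinnertonDyer.Theorems.ManinLocalTwoThreeManinConstantSixtyFour
import Summits.BirchSwinnertonDyer.BirchSwinnertonDyer.Theorems.ManinLocalTwoThreeManinConstantSeventyTwo
import Summits.BirchSwinnertonDyer.BirchSwinnertonDyer.Theorems.ManinLocalTwoThreeManinConstantFiftyTwo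
import Summits.BirchSwinnertonDyer.BirchSwinnertonDyer.Theorems.ManinLocalTwoThreeBracketSturmFiftyFour
import Summits.BirchSwinnertonDyer.BirchSwinnertonDyer.Theorems.ManinLocalTwoThreeManinConstantSixtyThree
import Literature.NumberTheory.EllipticCurves.ManinConstantQuadraticTwistLimbProofs
import Literature.NumberTheory.EllipticCurves.RootNumberTwistProofs
import Literature.NumberTheory.EllipticCurves.BSDSelmerCMPConverseMaximalOrderProofs
import Literature.NumberTheory.LFunctions.PrimitiveQuadraticCharacterGaussSum
import HarnessLib

/-!
# TWIST PROPAGATION OF THE FACT-FREE LEVELS: `|c| = 1` on fifteen infinite families of additive levels `M·p²`,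
# with NO printed fact (cell bsd-f2-manin, planner seat -desc gen 43, TURNKEY T-desc-55; landed by prover seat p1 gen 25
# with the T-desc-55 addendum of desc g44: the complete levels `52`, `54` and `63` added)

MEMO-desc §68 / CANDIDATES §E.67.  Lens = descent / visibility (transport of optimal quotients along the
`χ_{p*}`-twisting correspondence `X₀(M p²) ⇉ X₀(M)`).

THE ENGINE (THEOREM 68.A, `abs_maninConstant_eq_one_of_twist`).  `W/ℚ` globally minimal with an
`X₀(M)`-datum `D` of Manin constant `±1`, semistable at an odd prime `p`; `χ` any primitive quadratic
character mod `p`; `W'/ℚ` globally minimal with a LATTICE-OPTIMAL `X₀(N)`-datum `D'` (`M ∣ N`, `p² ∣ N`)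
whose newform is the `χ`-twist of that of `D` (`aₙ(f') = χ(n) aₙ(f)`).  THEN `|c(D')| = 1`.
Proof = the tree's PROVED `Γ₀` twist step `maninConstant_dvd_of_charTwist_gamma0` (`c(D') ∣ c(D)`;
inputs: Stevens 1989 Lemma (5.2) at odd `p`, PROVED as `stevens1989_neronLattice_quadraticTwist_oddPrime_holds`,
a minimal model of `W ⊗ χ_{p*}` (`hasGlobalMinimalModel_rat_holds`) with a Néron pair
(`exists_isNeronLatticeOf_holds`), Gauss `g(χ)² = p*`) and `|c(D)| = 1`.  No `exists_isNewformOf`, no CDT,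
no Cremona table, no Stevens Thm (7.1): NO NAMED FACT.

THE FAMILIES (THEOREM 68.B).  The cell's fifteen FACT-FREE COMPLETE LEVELS
`M ∈ {20, 24, 27, 32, 36, 40, 44, 45, 48, 52, 54, 56, 63, 64, 72}` (kernel theorems `abs_maninConstant_eq_one_<M>`, seats
p1/p2/p3/an, 2026-08-29/31; twelve one-class levels and the two-class levels `54`, `56`) feed `hD`; hence for EVERY odd prime `p` and every such `M`:
`TwistLevelManinOne M p` — `|c| = 1` (so `2 ∤ c`, `3 ∤ c`) for every lattice-optimal `X₀(N)`-datum
(`M ∣ N`, `p² ∣ N`; the newform case is `N = M p²`, `p ∤ M`) whose newform is a `χ_p`-twist of the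
newform of a lattice-optimal `X₀(M)`-datum on a curve semistable at `p`.  Fifteen infinite families of
ADDITIVE levels (`v₂(N) ∈ {2,3,4,5,6}` resp. `v₃(N) ∈ {2,3}`, Kodaira `I₀*` at `p`), unbounded conductor,
beyond every table; C2 `ManinOddAtFour` / C3 `ManinPrimeToThreeAtNine` hold on them with none of their
printed hypotheses.

PER-NEWFORM CLOSURE (THEOREM 68.C, `newformManinOne_twist`): «every lattice-optimal datum with newform
`g` has `|c| = 1`» passes from `g` (level `M`, some carrier curve with GOOD reduction at `p`) to every
`χ_p`-twist `g'` of `g` at any level `N`, `M ∣ N`, `p² ∣ N` (EXO `existsMinimalOptimalDatum_full` +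
isogeny-invariance of good reduction); iterating gives all good odd squarefree twists.

HONEST SCOPE.  Nothing here proves C2, C3, the rung, Manin's conjecture or BSD: the statements cover
exactly the twist-images of complete levels.  Instantiating «the optimal curve of the class of
`E_M ⊗ χ_{p*}`» needs a lattice-optimal datum of that class (EXO + modularity of the class — in the
kernel fact-free for `M = 32` by p2's `exists_latticeOptimalDatum_congruent`, else `exists_isNewformOf`)
and the coefficient relation (from `IsNewformOf` + `cuspCoeff_charTwist` / `LFunction_quadraticTwist_pStar_apply`).
Source: `HOME/desc/g43/Sketch-desc-g43.lean` (sha16 7752395cd8269776, farm rc 0, audited ref1 §R286/§R288) §0–§4 verbatim, plus the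
three complete levels `52` (p1 g24, p795564), `54` (p2 g29, p794219), `63` (p3 g24) in §3.  C2, C3, Manin's conjecture and BSD are NOT proved here.
[cite: Stevens1989, Lemma (5.2) p. 96, Lemma (5.4) p. 97] [cite: Shimura1971, Prop. 3.64]
[cite: EdixhovenManin1991, Prop. 2] [cite: Cremona1997, §2.8, §2.10]
-/

set_option autoImplicit false
set_option linter.dupNamespace false

noncomputable section

open scoped Classical NumberField MatrixGroups ModularForm

namespace Summit.BirchSwinnertonDyer.BirchSwinnertonDyer.Theorems.ManinLocalTwoThree.TwistFamilies

open WeierstrassCurve CongruenceSubgroup IsDedekindDomain IsDedekindDomain.HeightOneSpectrum Rat.HeightOneSpectrum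
  Literature.NumberTheory.Automorphic
  Literature.NumberTheory.EllipticCurves Literature.NumberTheory.EllipticCurves.ModularForms
  Literature.NumberTheory.LFunctions.PrimitiveQuadratic
  Summit.BirchSwinnertonDyer.BirchSwinnertonDyer.Theorems
  Summit.BirchSwinnertonDyer.BirchSwinnertonDyer.Theorems.ManinLocalTwoThree

/-! ## §0 Integer bookkeeping -/

/-- `c' ∣ c`, `|c| = 1` ⇒ `|c'| = 1`. [folklore] -/
theorem abs_eq_one_of_dvd_of_abs_eq_one {c c' : ℤ} (h : c' ∣ c) (hc : |c| = 1) : |c'| = 1 := by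
  have h1 : c'.natAbs ∣ c.natAbs := Int.natAbs_dvd_natAbs.mpr h
  have hc1 : c.natAbs = 1 := by
    rw [Int.abs_eq_natAbs] at hc
    exact_mod_cast hc
  rw [hc1, Nat.dvd_one] at h1
  rw [Int.abs_eq_natAbs, h1, Nat.cast_one]

/-- `|c| = 1`, `|q| ≠ 1` ⇒ `q ∤ c` (used with `q = 2, 3`). [folklore] -/
theorem not_dvd_of_abs_eq_one {c : ℤ} (hc : |c| = 1) {q : ℤ} (hq : q.natAbs ≠ 1) : ¬ q ∣ c := by
  rintro ⟨k, rfl⟩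
  rw [Int.abs_eq_natAbs, Int.natAbs_mul] at hc
  have h : q.natAbs * k.natAbs = 1 := by exact_mod_cast hc
  exact hq (Nat.eq_one_of_mul_eq_one_right h)

/-! ## §1 THE ENGINE (THEOREM 68.A): `|c| = 1` ascends along a good/multiplicative odd prime twist -/

/-- **THEOREM 68.A — twist propagation of `|c| = 1`, NO NAMED FACT.**  `W` globally minimal with an
`X₀(M)`-datum `D`, `|c(D)| = 1`, `W` good or multiplicative at the odd prime `p`; `χ` primitive quadratic
mod `p`; `W'` globally minimal with a lattice-optimal `X₀(N)`-datum `D'`, `M ∣ N`, `p² ∣ N`,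
`aₙ(D'.f) = χ(n)·aₙ(D.f)` for all `n`.  Then `|c(D')| = 1`.  Chain: `χ = (·/p)` (`eq_jacobiChar_of_odd`),
`g(χ)² = p*` (`gaussSum_quadraticChar_ringHomComp_sq`), a minimal model `C` of `W ⊗ ℚ(√p*)` with a Néron
pair `Λ_C = g(χ)⁻¹ Λ_W` (Stevens (5.2), PROVED), the `Γ₀` twist step `c(D') ∣ c(D)` (PROVED), §0.
[cite: Stevens1989, Lemma (5.2) p. 96, Lemma (5.4) p. 97] [cite: Shimura1971, Prop. 3.64] -/
theorem abs_maninConstant_eq_one_of_twist {p : ℕ} [Fact p.Prime] (hp2 : p ≠ 2)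
    {χ : DirichletCharacter ℂ p} (hχ : χ.IsQuadratic) (hprim : χ.IsPrimitive)
    {W : WeierstrassCurve ℚ} [W.IsElliptic] [W.IsGloballyMinimal] {M : ℕ} [NeZero M]
    (D : ModularParametrizationData W M) (hD : |D.maninConstant| = 1)
    (hsemi : W.HasGoodReductionAtPrime p ∨ W.HasMultiplicativeReductionAtPrime p)
    {W' : WeierstrassCurve ℚ} [W'.IsElliptic] [W'.IsGloballyMinimal] {N : ℕ} [NeZero N]
    (D' : ModularParametrizationData W' N) (hMN : M ∣ N) (hpN : p ^ 2 ∣ N)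
    (hf : ∀ n : ℕ, cuspCoeff D'.f n = χ n * cuspCoeff D.f n)
    (hopt' : ∀ z ∈ D'.L.lattice, ∃ w ∈ periodLattice D'.f, z = D'.c * w) :
    |D'.maninConstant| = 1 := by
  have hpP : p.Prime := Fact.out
  haveI : NeZero p := ⟨hpP.ne_zero⟩
  have hodd : Odd p := hpP.odd_of_ne_two hp2
  -- the character is the Legendre character
  have hχeq : χ = (quadraticChar (ZMod p)).ringHomComp (Int.castRingHom ℂ) := by
    rw [eq_jacobiChar_of_odd hodd hprim hχ,
      eq_jacobiChar_of_odd hodd (isPrimitive_quadraticChar_ringHomComp p hp2)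
        (isQuadratic_quadraticChar_ringHomComp p)]
  have hG : gaussSum χ (ZMod.stdAddChar (N := p)) ^ 2 = (((-1 : ℤ) ^ (p / 2) * p : ℤ) : ℂ) := by
    rw [hχeq]; exact gaussSum_quadraticChar_ringHomComp_sq p hp2
  -- a minimal model `C` of `W ⊗ ℚ(√p*)` and a Néron pair of it
  have hd0 : ((((-1 : ℤ) ^ (p / 2) * p : ℤ)) : ℚ) ≠ 0 := by
    push_cast
    exact mul_ne_zero (pow_ne_zero _ (by norm_num)) (by exact_mod_cast hpP.ne_zero)
  haveI : (W.quadraticTwist (((-1 : ℤ) ^ (p / 2) * p : ℤ) : ℚ)).IsElliptic :=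
    W.isElliptic_quadraticTwist hd0
  obtain ⟨vC, hvC⟩ := hasGlobalMinimalModel_rat_holds (W.quadraticTwist (((-1 : ℤ) ^ (p / 2) * p : ℤ) : ℚ))
  haveI := hvC
  haveI : ((vC • W.quadraticTwist (((-1 : ℤ) ^ (p / 2) * p : ℤ) : ℚ)).baseChange ℂ).IsElliptic := by
    rw [WeierstrassCurve.baseChange]; infer_instance
  obtain ⟨LC, hC⟩ := exists_isNeronLatticeOf_holds
    ((vC • W.quadraticTwist (((-1 : ℤ) ^ (p / 2) * p : ℤ) : ℚ)).baseChange ℂ)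
  -- Stevens (5.2): `Λ_C = g(χ)⁻¹ Λ_W`
  have hLC : ∀ z : ℂ, z ∈ LC.lattice ↔ gaussSum χ (ZMod.stdAddChar (N := p)) * z ∈ D.L.lattice :=
    stevens1989_neronLattice_quadraticTwist_oddPrime_holds W D.L D.isNeronLattice p hp2 hsemi
      _ ⟨vC, rfl⟩ LC hC _ hG
  -- the `Γ₀` twist step
  have hdvd : D'.c ∣ D.c := maninConstant_dvd_of_charTwist_gamma0 D D' hopt' hχ hprim hMN hpN hf hC hLC
  exact abs_eq_one_of_dvd_of_abs_eq_one hdvd hD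

/-- **THEOREM 68.A in `charTwist` form** (the binders of desc E-215RC / S-224): `D'.f = (D.f) ⊗ χ`. -/
theorem abs_maninConstant_eq_one_of_charTwist {p : ℕ} [Fact p.Prime] (hp2 : p ≠ 2)
    {χ : DirichletCharacter ℂ p} (hχ : χ.IsQuadratic) (hprim : χ.IsPrimitive)
    {W : WeierstrassCurve ℚ} [W.IsElliptic] [W.IsGloballyMinimal] {M : ℕ} [NeZero M]
    (D : ModularParametrizationData W M) (hD : |D.maninConstant| = 1)
    (hsemi : W.HasGoodReductionAtPrime p ∨ W.HasMultiplicativeReductionAtPrime p)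
    {W' : WeierstrassCurve ℚ} [W'.IsElliptic] [W'.IsGloballyMinimal] {N : ℕ} [NeZero N]
    (D' : ModularParametrizationData W' N) (hMN : M ∣ N) (hpN : p ^ 2 ∣ N)
    (hf' : D'.f = charTwist N hMN hpN hχ D.f)
    (hopt' : ∀ z ∈ D'.L.lattice, ∃ w ∈ periodLattice D'.f, z = D'.c * w) :
    |D'.maninConstant| = 1 :=
  haveI : NeZero p := ⟨(Fact.out : p.Prime).ne_zero⟩
  abs_maninConstant_eq_one_of_twist hp2 hχ hprim D hD hsemi D' hMN hpN
    (fun n ↦ by rw [hf', cuspCoeff_charTwist N hMN hpN hχ hprim]) hopt'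

/-! ## §2 The typed objects (E-desc-225 / E-desc-226 / E-desc-227) -/

/-- **E-desc-225 `LevelManinOne M`** — FACT-FREE COMPLETENESS OF THE LEVEL `M`: every lattice-optimal
`X₀(M)`-datum of a globally minimal elliptic curve has Manin constant `±1`.  In the tree for
`M ∈ {20,24,27,32,36,40,44,45,48,52,54,56,63,64,72}` (§3).  [cite: EdixhovenManin1991, §1] -/
def LevelManinOne (M : ℕ) [NeZero M] : Prop :=
  ∀ (W : WeierstrassCurve ℚ) [W.IsElliptic] [W.IsGloballyMinimal] (D : ModularParametrizationData W M),
    (∀ z ∈ D.L.lattice, ∃ w ∈ periodLattice D.f, z = D.c * w) → |D.maninConstant| = 1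

/-- **E-desc-226 `TwistLevelManinOne M p`** — `|c| = 1` ON THE `p`-TWIST IMAGE OF LEVEL `M`: for every
primitive quadratic `χ` mod `p`, every lattice-optimal `X₀(M)`-datum `D` on a globally minimal curve good
or multiplicative at `p`, and every lattice-optimal `X₀(N)`-datum `D'` (`M ∣ N`, `p² ∣ N`) on a globally
minimal curve with `aₙ(D'.f) = χ(n) aₙ(D.f)`: `|c(D')| = 1`.  THEOREM for the fifteen complete `M` and
every odd prime `p` (§3).  [cite: Stevens1989, Lemma (5.2), (5.4)] -/
def TwistLevelManinOne (M p : ℕ) [NeZero M] [Fact p.Prime] : Prop :=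
  ∀ (χ : DirichletCharacter ℂ p), χ.IsQuadratic → χ.IsPrimitive →
  ∀ (W : WeierstrassCurve ℚ) [W.IsElliptic] [W.IsGloballyMinimal] (D : ModularParametrizationData W M),
    (∀ z ∈ D.L.lattice, ∃ w ∈ periodLattice D.f, z = D.c * w) →
    (W.HasGoodReductionAtPrime p ∨ W.HasMultiplicativeReductionAtPrime p) →
  ∀ (W' : WeierstrassCurve ℚ) [W'.IsElliptic] [W'.IsGloballyMinimal] (N : ℕ) [NeZero N]
    (D' : ModularParametrizationData W' N), M ∣ N → p ^ 2 ∣ N →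
    (∀ n : ℕ, cuspCoeff D'.f n = χ n * cuspCoeff D.f n) →
    (∀ z ∈ D'.L.lattice, ∃ w ∈ periodLattice D'.f, z = D'.c * w) → |D'.maninConstant| = 1

/-- **E-desc-227 `NewformManinOne g`** — the per-newform property: every lattice-optimal datum (on a
globally minimal elliptic curve) whose newform is `g` has `|c| = 1`. [cite: EdixhovenManin1991, §1] -/
def NewformManinOne {N : ℕ} [NeZero N] (g : CuspForm (Gamma0 N) 2) : Prop :=
  ∀ (W : WeierstrassCurve ℚ) [W.IsElliptic] [W.IsGloballyMinimal] (D : ModularParametrizationData W N),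
    D.f = g → (∀ z ∈ D.L.lattice, ∃ w ∈ periodLattice D.f, z = D.c * w) → |D.maninConstant| = 1

/-- **LevelManinOne ⇒ TwistLevelManinOne at every odd prime** (THEOREM 68.A, universally). -/
theorem twistLevelManinOne_of_levelManinOne {M : ℕ} [NeZero M] (hM : LevelManinOne M)
    {p : ℕ} [Fact p.Prime] (hp2 : p ≠ 2) : TwistLevelManinOne M p := by
  intro χ hχ hprim W _ _ D hopt hsemi W' _ _ N _ D' hMN hpN hf hopt'
  exact abs_maninConstant_eq_one_of_twist hp2 hχ hprim D (hM W D hopt) hsemi D' hMN hpN hf hopt'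

/-- **THEOREM 68.C — per-newform closure under good odd prime twists.**  If every lattice-optimal datum
with newform `g = D₀.f` (level `M`; `D₀` any datum of any elliptic `W₀` GOOD at the odd prime `p`) has
`|c| = 1`, then so does every lattice-optimal datum whose newform `g'` (any level `N`, `M ∣ N`, `p² ∣ N`)
satisfies `aₙ(g') = χ(n) aₙ(g)`, `χ` primitive quadratic mod `p`.  Extra inputs: EXO
(`existsMinimalOptimalDatum_full`, unconditional) and isogeny invariance of good reduction
(`IsIsogenous.hasGoodReductionAtPrime_iff`).  Iterating: all good odd squarefree twists.
[cite: Stevens1989, Lemma (5.2), (5.4)] [cite: EdixhovenManin1991, Prop. 2] [cite: SilvermanAEC2009, Cor. VII.7.2] -/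
theorem newformManinOne_twist {p : ℕ} [Fact p.Prime] (hp2 : p ≠ 2)
    {χ : DirichletCharacter ℂ p} (hχ : χ.IsQuadratic) (hprim : χ.IsPrimitive)
    {W₀ : WeierstrassCurve ℚ} [W₀.IsElliptic] {M : ℕ} [NeZero M] (D₀ : ModularParametrizationData W₀ M)
    (hgood : W₀.HasGoodReductionAtPrime p) (h : NewformManinOne D₀.f)
    {N : ℕ} [NeZero N] (hMN : M ∣ N) (hpN : p ^ 2 ∣ N) (g' : CuspForm (Gamma0 N) 2)
    (hg' : ∀ n : ℕ, cuspCoeff g' n = χ n * cuspCoeff D₀.f n) : NewformManinOne g' := by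
  intro W' _ _ D' hf' hopt'
  obtain ⟨W₁, hE₁, hM₁, D₁, hf₁, hiso, hopt₁, -⟩ := ExistsMinimalOptimalDatum.existsMinimalOptimalDatum_full W₀ D₀
  haveI := hE₁
  haveI := hM₁
  have hD₁ : |D₁.maninConstant| = 1 := h W₁ D₁ hf₁ hopt₁
  have hgood₁ : W₁.HasGoodReductionAtPrime p := (hiso.hasGoodReductionAtPrime_iff p).mp hgood
  exact abs_maninConstant_eq_one_of_twist hp2 hχ hprim D₁ hD₁ (Or.inl hgood₁) D' hMN hpN
    (fun n ↦ by rw [hf', hg', hf₁]) hopt'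

/-- **LevelManinOne M ⇒ NewformManinOne for every `p`-twisted newform of a level-`M` newform** carried
by a curve good at `p` (68.C fed by 68.B's hypothesis). -/
theorem newformManinOne_twist_of_levelManinOne {M : ℕ} [NeZero M] (hM : LevelManinOne M)
    {p : ℕ} [Fact p.Prime] (hp2 : p ≠ 2)
    {χ : DirichletCharacter ℂ p} (hχ : χ.IsQuadratic) (hprim : χ.IsPrimitive)
    {W₀ : WeierstrassCurve ℚ} [W₀.IsElliptic] (D₀ : ModularParametrizationData W₀ M)
    (hgood : W₀.HasGoodReductionAtPrime p)
    {N : ℕ} [NeZero N] (hMN : M ∣ N) (hpN : p ^ 2 ∣ N) (g' : CuspForm (Gamma0 N) 2)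
    (hg' : ∀ n : ℕ, cuspCoeff g' n = χ n * cuspCoeff D₀.f n) : NewformManinOne g' :=
  newformManinOne_twist hp2 hχ hprim D₀ hgood (fun W _ _ D _ hopt ↦ hM W D hopt) hMN hpN g' hg'

/-! ## §3 The fifteen fact-free complete levels and their twist families (THEOREM 68.B) -/

/-- level `20 = 2²·5` (p2, η-identities): `LevelManinOne`, fact-free. -/
theorem levelManinOne_twenty : LevelManinOne 20 :=
  fun W _ _ D h ↦ EtaIdentitiesTwenty.abs_maninConstant_eq_one_twenty W D h
/-- level `24 = 2³·3` (η-identities): `LevelManinOne`, fact-free. -/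
theorem levelManinOne_twentyFour : LevelManinOne 24 :=
  fun W _ _ D h ↦ EtaIdentitiesTwentyFour.abs_maninConstant_eq_one_twentyFour W D h
/-- level `27 = 3³` (Ligozat identities): `LevelManinOne`, fact-free. -/
theorem levelManinOne_twentySeven : LevelManinOne 27 :=
  fun W _ _ D h ↦ LigozatIdentities.abs_maninConstant_eq_one_twentySeven W D h
/-- level `32 = 2⁵` (Ligozat identities): `LevelManinOne`, fact-free. -/
theorem levelManinOne_thirtyTwo : LevelManinOne 32 :=
  fun W _ _ D h ↦ LigozatIdentitiesThirtyTwo.abs_maninConstant_eq_one_thirtyTwo W D h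
/-- level `36 = 2²·3²` (Ligozat identities): `LevelManinOne`, fact-free. -/
theorem levelManinOne_thirtySix : LevelManinOne 36 :=
  fun W _ _ D h ↦ LigozatIdentitiesThirtySix.abs_maninConstant_eq_one_thirtySix W D h
/-- level `40 = 2³·5` (η-identities): `LevelManinOne`, fact-free. -/
theorem levelManinOne_forty : LevelManinOne 40 :=
  fun W _ _ D h ↦ EtaIdentitiesForty.abs_maninConstant_eq_one_forty W D h
/-- level `44 = 2²·11` (p1 g24, p788924): `LevelManinOne`, fact-free. -/
theorem levelManinOne_fortyFour : LevelManinOne 44 :=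
  fun W _ _ D h ↦ ManinConstantFortyFour.abs_maninConstant_eq_one_fortyFour W D h
/-- level `45 = 3²·5` (p2 g29): `LevelManinOne`, fact-free. -/
theorem levelManinOne_fortyFive : LevelManinOne 45 :=
  fun W _ _ D h ↦ ManinConstantFortyFive.abs_maninConstant_eq_one_fortyFive W D h
/-- level `48 = 2⁴·3` (p2, η-identities): `LevelManinOne`, fact-free. -/
theorem levelManinOne_fortyEight : LevelManinOne 48 :=
  fun W _ _ D h ↦ EtaIdentitiesFortyEight.abs_maninConstant_eq_one_fortyEight W D h
/-- level `52 = 2²·13` (Fricke-sieve pinning + Bracket–Sturm certificate; p1 g24, p795564) -/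
theorem levelManinOne_fiftyTwo : LevelManinOne 52 :=
  fun W _ _ D h ↦ ManinConstantFiftyTwo.abs_maninConstant_eq_one_fiftyTwo W D h
/-- level `54 = 2·3³` (TWO newforms `54a`, `54b`; p2 g29, p794219) -/
theorem levelManinOne_fiftyFour : LevelManinOne 54 :=
  fun W _ _ D h ↦ LevelFiftyFour.abs_maninConstant_eq_one_fiftyFour W D h
/-- level `56 = 2³·7` (TWO newforms `56a`, `56b`; p2 g28, p782542 ff.) -/
theorem levelManinOne_fiftySix : LevelManinOne 56 :=
  fun W _ _ D h ↦ ManinConstantFiftySix.abs_maninConstant_eq_one_fiftySix W D h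
/-- level `63 = 3²·7` (Fricke-sieve pinning + Bracket–Sturm certificate of `63a`; p3 g24) -/
theorem levelManinOne_sixtyThree : LevelManinOne 63 :=
  fun W _ _ D h ↦ LevelSixtyThree.abs_maninConstant_eq_one_sixtyThree W D h
/-- level `64 = 2⁶`: `LevelManinOne`, fact-free. -/
theorem levelManinOne_sixtyFour : LevelManinOne 64 :=
  fun W _ _ D h ↦ ManinConstantSixtyFour.abs_maninConstant_eq_one_sixtyFour W D h
/-- level `72 = 2³·3²` (p3 g24): `LevelManinOne`, fact-free. -/
theorem levelManinOne_seventyTwo : LevelManinOne 72 :=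
  fun W _ _ D h ↦ ManinConstantSeventyTwo.abs_maninConstant_eq_one_seventyTwo W D h

/-- **THEOREM 68.B — the fifteen infinite twist families, NO NAMED FACT.**  For every odd prime `p`:
`|c| = 1` on the `p`-twist image of each complete level (levels `20p², 24p², 27p², 32p², 36p², 40p², 44p²,
45p², 48p², 52p², 54p², 56p², 63p², 64p², 72p²` and their multiples `N` with `M ∣ N`, `p² ∣ N`; `54p²` and `56p²` carry two
classes). -/
theorem twistLevelManinOne_families {p : ℕ} [Fact p.Prime] (hp2 : p ≠ 2) :
    TwistLevelManinOne 20 p ∧ TwistLevelManinOne 24 p ∧ TwistLevelManinOne 27 p ∧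
    TwistLevelManinOne 32 p ∧ TwistLevelManinOne 36 p ∧ TwistLevelManinOne 40 p ∧
    TwistLevelManinOne 44 p ∧ TwistLevelManinOne 45 p ∧ TwistLevelManinOne 48 p ∧
    TwistLevelManinOne 52 p ∧ TwistLevelManinOne 54 p ∧ TwistLevelManinOne 56 p ∧
    TwistLevelManinOne 63 p ∧ TwistLevelManinOne 64 p ∧ TwistLevelManinOne 72 p :=
  ⟨twistLevelManinOne_of_levelManinOne levelManinOne_twenty hp2,
   twistLevelManinOne_of_levelManinOne levelManinOne_twentyFour hp2,
   twistLevelManinOne_of_levelManinOne levelManinOne_twentySeven hp2,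
   twistLevelManinOne_of_levelManinOne levelManinOne_thirtyTwo hp2,
   twistLevelManinOne_of_levelManinOne levelManinOne_thirtySix hp2,
   twistLevelManinOne_of_levelManinOne levelManinOne_forty hp2,
   twistLevelManinOne_of_levelManinOne levelManinOne_fortyFour hp2,
   twistLevelManinOne_of_levelManinOne levelManinOne_fortyFive hp2,
   twistLevelManinOne_of_levelManinOne levelManinOne_fortyEight hp2,
   twistLevelManinOne_of_levelManinOne levelManinOne_fiftyTwo hp2,
   twistLevelManinOne_of_levelManinOne levelManinOne_fiftyFour hp2,
   twistLevelManinOne_of_levelManinOne levelManinOne_fiftySix hp2,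
   twistLevelManinOne_of_levelManinOne levelManinOne_sixtyThree hp2,
   twistLevelManinOne_of_levelManinOne levelManinOne_sixtyFour hp2,
   twistLevelManinOne_of_levelManinOne levelManinOne_seventyTwo hp2⟩

/-! ## §4 The C2 / C3 shapes on the families -/

/-- **C2-shape (`2 ∤ c`) and C3-shape (`3 ∤ c`) on a twist image**: `TwistLevelManinOne M p` gives
`2 ∤ c(D')` and `3 ∤ c(D')` for the same data — the conclusions of the cruxes `ManinOddAtFour` /
`ManinPrimeToThreeAtNine` on these classes with NONE of their printed hypotheses. -/
theorem not_two_dvd_and_not_three_dvd_of_twistLevelManinOne {M p : ℕ} [NeZero M] [Fact p.Prime]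
    (h : TwistLevelManinOne M p) (χ : DirichletCharacter ℂ p) (hχ : χ.IsQuadratic) (hprim : χ.IsPrimitive)
    (W : WeierstrassCurve ℚ) [W.IsElliptic] [W.IsGloballyMinimal] (D : ModularParametrizationData W M)
    (hopt : ∀ z ∈ D.L.lattice, ∃ w ∈ periodLattice D.f, z = D.c * w)
    (hsemi : W.HasGoodReductionAtPrime p ∨ W.HasMultiplicativeReductionAtPrime p)
    (W' : WeierstrassCurve ℚ) [W'.IsElliptic] [W'.IsGloballyMinimal] (N : ℕ) [NeZero N]
    (D' : ModularParametrizationData W' N) (hMN : M ∣ N) (hpN : p ^ 2 ∣ N)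
    (hf : ∀ n : ℕ, cuspCoeff D'.f n = χ n * cuspCoeff D.f n)
    (hopt' : ∀ z ∈ D'.L.lattice, ∃ w ∈ periodLattice D'.f, z = D'.c * w) :
    ¬ (2 : ℤ) ∣ D'.maninConstant ∧ ¬ (3 : ℤ) ∣ D'.maninConstant :=
  have h1 := h χ hχ hprim W D hopt hsemi W' N D' hMN hpN hf hopt'
  ⟨not_dvd_of_abs_eq_one h1 (by decide), not_dvd_of_abs_eq_one h1 (by decide)⟩

/-- **`2 ∤ c` on the eleven `4 ∣ M` families and `3 ∤ c` on the six `9 ∣ M` families, every odd `p`** —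
e.g. the optimal curve of the class of `20a ⊗ χ_{p*}` (`N = 20p²`, Kodaira IV at `2`, `I₀*` at `p`). -/
theorem maninOddAtFour_shape_on_family_twenty {p : ℕ} [Fact p.Prime] (hp2 : p ≠ 2)
    (χ : DirichletCharacter ℂ p) (hχ : χ.IsQuadratic) (hprim : χ.IsPrimitive)
    (W : WeierstrassCurve ℚ) [W.IsElliptic] [W.IsGloballyMinimal] (D : ModularParametrizationData W 20)
    (hopt : ∀ z ∈ D.L.lattice, ∃ w ∈ periodLattice D.f, z = D.c * w)
    (hsemi : W.HasGoodReductionAtPrime p ∨ W.HasMultiplicativeReductionAtPrime p)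
    (W' : WeierstrassCurve ℚ) [W'.IsElliptic] [W'.IsGloballyMinimal] [NeZero (20 * p ^ 2)]
    (D' : ModularParametrizationData W' (20 * p ^ 2))
    (hf : ∀ n : ℕ, cuspCoeff D'.f n = χ n * cuspCoeff D.f n)
    (hopt' : ∀ z ∈ D'.L.lattice, ∃ w ∈ periodLattice D'.f, z = D'.c * w) :
    |D'.maninConstant| = 1 ∧ ¬ (2 : ℤ) ∣ D'.maninConstant :=
  have h1 := twistLevelManinOne_of_levelManinOne levelManinOne_twenty hp2 χ hχ hprim W D hopt hsemi W'
    (20 * p ^ 2) D' (dvd_mul_right 20 (p ^ 2)) (dvd_mul_left (p ^ 2) 20) hf hopt'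
  ⟨h1, not_dvd_of_abs_eq_one h1 (by decide)⟩

/-- The `3`-adic instance: `3 ∤ c` on the family of `45a ⊗ χ_{p*}` (`N = 45p²`, `9 ∥ N`). -/
theorem maninPrimeToThreeAtNine_shape_on_family_fortyFive {p : ℕ} [Fact p.Prime] (hp2 : p ≠ 2)
    (χ : DirichletCharacter ℂ p) (hχ : χ.IsQuadratic) (hprim : χ.IsPrimitive)
    (W : WeierstrassCurve ℚ) [W.IsElliptic] [W.IsGloballyMinimal] (D : ModularParametrizationData W 45)
    (hopt : ∀ z ∈ D.L.lattice, ∃ w ∈ periodLattice D.f, z = D.c * w)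
    (hsemi : W.HasGoodReductionAtPrime p ∨ W.HasMultiplicativeReductionAtPrime p)
    (W' : WeierstrassCurve ℚ) [W'.IsElliptic] [W'.IsGloballyMinimal] [NeZero (45 * p ^ 2)]
    (D' : ModularParametrizationData W' (45 * p ^ 2))
    (hf : ∀ n : ℕ, cuspCoeff D'.f n = χ n * cuspCoeff D.f n)
    (hopt' : ∀ z ∈ D'.L.lattice, ∃ w ∈ periodLattice D'.f, z = D'.c * w) :
    |D'.maninConstant| = 1 ∧ ¬ (3 : ℤ) ∣ D'.maninConstant :=
  have h1 := twistLevelManinOne_of_levelManinOne levelManinOne_fortyFive hp2 χ hχ hprim W D hopt hsemi W'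
    (45 * p ^ 2) D' (dvd_mul_right 45 (p ^ 2)) (dvd_mul_left (p ^ 2) 45) hf hopt'
  ⟨h1, not_dvd_of_abs_eq_one h1 (by decide)⟩


end Summit.BirchSwinnertonDyer.BirchSwinnertonDyer.Theorems.ManinLocalTwoThree.TwistFamilies

end
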